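import Summits.NavierStokesRegularity.NavierStokesRegularity.Theorems.CoriolisHeadLocalEnergyLinearDensity
import Literature.Analysis.FluidPDE.AxisymmetricTypeIPressureBounds
import Literature.Analysis.FluidPDE.CKNEpsilonRegularityLemma142Holds
import HarnessLib

/-!
# CoriolisHeadLocalEnergyPressureGauge — crux `NoCoRotatingCore` (stmt-NavierStokesRegularity-22676), line
# `local_energy_rescue` v2.1 (crux workfile, ns-idea-10 g3; unregistered), stub S3a `stub_localEnergyClass` —
# file 4: a CONSTANT pressure gauge and the `L^{3/2}` slices of the physical pressure

Two bookkeeping steps for the CKN class `hp` (`p ∈ L^{3/2}(Q₁)`) of S3a (ii):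

* `exists_const_gauge_of_sq_oscillation` — if the mean oscillation of `P` on the balls `B(0,ρ)` decays linearly,
  `∫_{B(0,ρ)}(P − m_ρ)² ≤ K₁ρ` (`ρ ≥ 1`, SOME gauge `m_ρ` per radius — what linear energy density and the Calderón–Zygmund
  round of the line give), then ONE constant `m_∞` serves all radii: `∫_{B(0,ρ)}(P − m_∞)² ≤ 52K₁ρ`.  The dyadic gauges
  `m_{2^k}` form a Cauchy sequence (`|m_{2^k} − m_{2^{k+1}}| ≤ √(6K₁/|B₁|)·2^{−k}`, Mathlib `cauchySeq_of_le_geometric`) and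
  `|m_{2^k} − m_∞| ≲ 2^{−k}` costs `|B_ρ|ρ^{−2} ≲ ρ`.  So the profile pressure can be renormalised by a CONSTANT (it stays a
  profile pressure, and the physical pressure stays classical — no time-dependent gauge is needed);
* `setIntegral_ball_abs_rpow_physicalPressure` — the `L^{3/2}` slice of the physical pressure `p(t) = λ²P(λe^{−θB}·)` is scale
  invariant: `∫_{B(x₀,r)}|p(t)|^{3/2} = ∫_{B(z_t,rλ)}|P|^{3/2}`;
* `lintegral_ball_rpow_threeHalves_le` — Hölder on a ball: `∫_{B(0,ρ)}(P')² ≤ K'ρ` gives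
  `∫⁻_{B(0,ρ)}‖P'‖ₑ^{3/2} ≤ ofReal((K'^{3/4}|B₁|^{1/4}) ρ^{3/2})` (tree `setLIntegral_rpow_threeHalves_le_of_sq`).

HONEST FRAMING.  Helper for an unregistered line's stub (S3a); nothing here proves `NoCoRotatingCore` or NS regularity.

References: L. Caffarelli, R. Kohn, L. Nirenberg, CPAM 35 (1982) §2 (2.3)–(2.5) [CaffarelliKohnNirenberg1982]; F. Lin, CPAM 51
(1998) §3 (the `L^{3/2}` pressure class) [Lin1998]; line card `Lines/local_energy_rescue.md` (S3a).
-/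

noncomputable section

open MeasureTheory Set Function Filter Topology Metric InnerProductSpace Real
open scoped RealInnerProductSpace Laplacian ContDiff Topology ENNReal NNReal

-- the summit and its single sub-problem share the name (CONVENTIONS §1), as in every Theorems file
set_option linter.dupNamespace false
-- nested operator types `ℝ³ →L[ℝ] ℝ³` inside the Banach algebra `ℝ³ →L[ℝ] ℝ³` (as in `CoriolisHeadTypeIRateTransport`)
set_option maxSynthPendingDepth 3

namespace Summit.NavierStokesRegularity.NavierStokesRegularity.Theorems.CoriolisHead

namespace LocalEnergyRescue

open Literature.Analysis.FluidPDE

/-! ## §1 A constant gauge from linearly decaying mean oscillation -/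

/-- Comparing two gauges on one ball: `|B(0,ρ)| (m₁ − m₂)² ≤ 2∫_{B(0,ρ)}(P − m₁)² + 2∫_{B(0,ρ)}(P − m₂)²`. [folklore] -/
theorem measureReal_ball_mul_sq_sub_le {P : EuclideanSpace ℝ (Fin 3) → ℝ} (hPc : Continuous P) {ρ : ℝ}
    (m₁ m₂ : ℝ) :
    (volume (ball (0 : EuclideanSpace ℝ (Fin 3)) ρ)).toReal * (m₁ - m₂) ^ 2 ≤
      2 * (∫ y in ball (0 : EuclideanSpace ℝ (Fin 3)) ρ, (P y - m₁) ^ 2) +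
        2 * ∫ y in ball (0 : EuclideanSpace ℝ (Fin 3)) ρ, (P y - m₂) ^ 2 := by
  have i1 : IntegrableOn (fun y => (P y - m₁) ^ 2) (ball (0 : EuclideanSpace ℝ (Fin 3)) ρ) volume :=
    (((hPc.sub continuous_const).pow 2).continuousOn.integrableOn_compact (isCompact_closedBall 0 ρ)).mono_set
      ball_subset_closedBall
  have i2 : IntegrableOn (fun y => (P y - m₂) ^ 2) (ball (0 : EuclideanSpace ℝ (Fin 3)) ρ) volume :=
    (((hPc.sub continuous_const).pow 2).continuousOn.integrableOn_compact (isCompact_closedBall 0 ρ)).mono_set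
      ball_subset_closedBall
  have hc : (volume (ball (0 : EuclideanSpace ℝ (Fin 3)) ρ)).toReal * (m₁ - m₂) ^ 2 =
      ∫ _ in ball (0 : EuclideanSpace ℝ (Fin 3)) ρ, (m₁ - m₂) ^ 2 := by
    rw [setIntegral_const, smul_eq_mul, Measure.real]
  have i3 : IntegrableOn (fun _ : EuclideanSpace ℝ (Fin 3) => (m₁ - m₂) ^ 2) (ball (0 : EuclideanSpace ℝ (Fin 3)) ρ)
      volume := integrableOn_const (measure_ball_lt_top.ne)
  rw [hc, ← integral_const_mul, ← integral_const_mul, ← integral_add (i1.const_mul 2) (i2.const_mul 2)]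
  refine setIntegral_mono_on i3 ((i1.const_mul 2).add (i2.const_mul 2)) measurableSet_ball fun y _ => ?_
  nlinarith [sq_nonneg (P y - m₁ + (P y - m₂)), sq_nonneg (P y - m₁ - (P y - m₂))]

/-- **A constant gauge from linearly decaying mean oscillation.**  If `P` is continuous and for every `ρ ≥ 1` some
constant `m_ρ` has `∫_{B(0,ρ)}(P − m_ρ)² ≤ K₁ρ`, then there is ONE constant `m_∞` with `∫_{B(0,ρ)}(P − m_∞)² ≤ 52K₁ρ`
for all `ρ ≥ 1`: the dyadic gauges `m_{2^k}` satisfy `|B_{2^k}|(m_{2^k} − m_{2^{k+1}})² ≤ 6K₁2^k`, hence form a Cauchy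
sequence with `|m_{2^k} − m_∞| ≤ 2√(6K₁/|B₁|) 2^{−k}`, and on `B(0,ρ)`, `2^n ≤ ρ < 2^{n+1}`, the cost of replacing
`m_{2^{n+1}}` by `m_∞` is `2|B_ρ| (m_{2^{n+1}} − m_∞)² ≤ 48K₁ρ`. [folklore] -/
theorem exists_const_gauge_of_sq_oscillation {P : EuclideanSpace ℝ (Fin 3) → ℝ} (hPc : Continuous P) {K₁ : ℝ}
    (hK : ∀ ρ : ℝ, 1 ≤ ρ → ∃ m : ℝ, ∫ y in ball (0 : EuclideanSpace ℝ (Fin 3)) ρ, (P y - m) ^ 2 ≤ K₁ * ρ) :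
    ∃ m : ℝ, ∀ ρ : ℝ, 1 ≤ ρ → ∫ y in ball (0 : EuclideanSpace ℝ (Fin 3)) ρ, (P y - m) ^ 2 ≤ 52 * K₁ * ρ := by
  set W : ℝ := (volume (ball (0 : EuclideanSpace ℝ (Fin 3)) 1)).toReal with hW
  have hWpos : 0 < W := by
    rw [hW]
    exact ENNReal.toReal_pos (measure_ball_pos volume 0 one_pos).ne' measure_ball_lt_top.ne
  have hK0 : 0 ≤ K₁ := by
    obtain ⟨m, hm⟩ := hK 1 le_rfl
    have h0 : 0 ≤ ∫ y in ball (0 : EuclideanSpace ℝ (Fin 3)) 1, (P y - m) ^ 2 := integral_nonneg fun y => sq_nonneg _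
    linarith
  -- volume of balls
  have hvol : ∀ ρ : ℝ, 0 < ρ → (volume (ball (0 : EuclideanSpace ℝ (Fin 3)) ρ)).toReal = W * ρ ^ 3 := fun ρ hρ => by
    rw [Measure.addHaar_ball_of_pos volume 0 hρ, finrank_euclideanSpace_fin, ENNReal.toReal_mul,
      ENNReal.toReal_ofReal (by positivity), hW, mul_comm]
  -- the dyadic gauges
  choose m hm using fun k : ℕ => hK (2 ^ k) (one_le_pow₀ (by norm_num : (1 : ℝ) ≤ 2))
  have hint : ∀ (k : ℕ) (c : ℝ), IntegrableOn (fun y => (P y - c) ^ 2) (ball (0 : EuclideanSpace ℝ (Fin 3)) (2 ^ (k + 1)))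
      volume := fun k c =>
    (((hPc.sub continuous_const).pow 2).continuousOn.integrableOn_compact (isCompact_closedBall 0 _)).mono_set
      ball_subset_closedBall
  -- consecutive gauges are close
  set C₀ : ℝ := Real.sqrt (6 * K₁ / W) with hC₀
  have hstep : ∀ k : ℕ, dist (m k) (m (k + 1)) ≤ C₀ * (1 / 2 : ℝ) ^ k := by
    intro k
    have h2k : (0 : ℝ) < 2 ^ k := by positivity
    have h1 := measureReal_ball_mul_sq_sub_le hPc (ρ := 2 ^ k) (m k) (m (k + 1))
    rw [hvol _ h2k] at h1
    have hmono : ∫ y in ball (0 : EuclideanSpace ℝ (Fin 3)) (2 ^ k), (P y - m (k + 1)) ^ 2 ≤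
        ∫ y in ball (0 : EuclideanSpace ℝ (Fin 3)) (2 ^ (k + 1)), (P y - m (k + 1)) ^ 2 :=
      setIntegral_mono_set (hint k _) (ae_of_all _ fun y => sq_nonneg _)
        (ae_of_all _ (ball_subset_ball (pow_le_pow_right₀ (by norm_num) (Nat.le_succ k))))
    have h3 : W * (2 ^ k) ^ 3 * (m k - m (k + 1)) ^ 2 ≤ 6 * K₁ * 2 ^ k := by
      have e : K₁ * 2 ^ (k + 1) = 2 * (K₁ * 2 ^ k) := by ring
      linarith [hm k, hmono, hm (k + 1), h1, e]
    have h2k2 : (0 : ℝ) < (2 ^ k) ^ 2 := by positivity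
    have h3' : W * (2 ^ k) ^ 2 * (m k - m (k + 1)) ^ 2 ≤ 6 * K₁ := by
      have h5 : 2 ^ k * (W * (2 ^ k) ^ 2 * (m k - m (k + 1)) ^ 2) ≤ 2 ^ k * (6 * K₁) := by
        calc 2 ^ k * (W * (2 ^ k) ^ 2 * (m k - m (k + 1)) ^ 2) = W * (2 ^ k) ^ 3 * (m k - m (k + 1)) ^ 2 := by ring
          _ ≤ 6 * K₁ * 2 ^ k := h3
          _ = 2 ^ k * (6 * K₁) := by ring
      exact le_of_mul_le_mul_left h5 h2k
    have h4 : (m k - m (k + 1)) ^ 2 ≤ (C₀ * (1 / 2 : ℝ) ^ k) ^ 2 := by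
      rw [mul_pow, hC₀, Real.sq_sqrt (by positivity), one_div, inv_pow, inv_pow, ← div_eq_mul_inv,
        le_div_iff₀ h2k2, le_div_iff₀ hWpos]
      linarith [h3', show (m k - m (k + 1)) ^ 2 * (2 ^ k) ^ 2 * W = W * (2 ^ k) ^ 2 * (m k - m (k + 1)) ^ 2 by ring]
    rw [Real.dist_eq]
    have hC₀0 : 0 ≤ C₀ * (1 / 2 : ℝ) ^ k := by positivity
    exact abs_le.2 (abs_le_of_sq_le_sq' h4 hC₀0)
  have hcauchy : CauchySeq m := cauchySeq_of_le_geometric (1 / 2 : ℝ) C₀ (by norm_num) hstep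
  obtain ⟨mInf, hmInf⟩ := cauchySeq_tendsto_of_complete hcauchy
  have hdist : ∀ n : ℕ, dist (m n) mInf ≤ C₀ * (1 / 2 : ℝ) ^ n / (1 - 1 / 2) :=
    dist_le_of_le_geometric_of_tendsto (1 / 2 : ℝ) C₀ (by norm_num) hstep hmInf
  refine ⟨mInf, fun ρ hρ => ?_⟩
  have hρ0 : 0 < ρ := by linarith
  obtain ⟨n, hn, hn1⟩ := exists_nat_pow_near hρ (by norm_num : (1 : ℝ) < 2)
  -- replace `m (n+1)` by `mInf` on `B(0,ρ) ⊆ B(0, 2^{n+1})`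
  have hmono : ∫ y in ball (0 : EuclideanSpace ℝ (Fin 3)) ρ, (P y - m (n + 1)) ^ 2 ≤
      ∫ y in ball (0 : EuclideanSpace ℝ (Fin 3)) (2 ^ (n + 1)), (P y - m (n + 1)) ^ 2 :=
    setIntegral_mono_set (hint n _) (ae_of_all _ fun y => sq_nonneg _) (ae_of_all _ (ball_subset_ball hn1.le))
  have i1 : IntegrableOn (fun y => (P y - mInf) ^ 2) (ball (0 : EuclideanSpace ℝ (Fin 3)) ρ) volume :=
    (((hPc.sub continuous_const).pow 2).continuousOn.integrableOn_compact (isCompact_closedBall 0 ρ)).mono_set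
      ball_subset_closedBall
  have i2 : IntegrableOn (fun y => (P y - m (n + 1)) ^ 2) (ball (0 : EuclideanSpace ℝ (Fin 3)) ρ) volume :=
    (((hPc.sub continuous_const).pow 2).continuousOn.integrableOn_compact (isCompact_closedBall 0 ρ)).mono_set
      ball_subset_closedBall
  have i3 : IntegrableOn (fun _ : EuclideanSpace ℝ (Fin 3) => (m (n + 1) - mInf) ^ 2)
      (ball (0 : EuclideanSpace ℝ (Fin 3)) ρ) volume := integrableOn_const (measure_ball_lt_top.ne)
  have hsplit : ∫ y in ball (0 : EuclideanSpace ℝ (Fin 3)) ρ, (P y - mInf) ^ 2 ≤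
      2 * (∫ y in ball (0 : EuclideanSpace ℝ (Fin 3)) ρ, (P y - m (n + 1)) ^ 2) +
        2 * ((volume (ball (0 : EuclideanSpace ℝ (Fin 3)) ρ)).toReal * (m (n + 1) - mInf) ^ 2) := by
    have hc : (volume (ball (0 : EuclideanSpace ℝ (Fin 3)) ρ)).toReal * (m (n + 1) - mInf) ^ 2 =
        ∫ _ in ball (0 : EuclideanSpace ℝ (Fin 3)) ρ, (m (n + 1) - mInf) ^ 2 := by
      rw [setIntegral_const, smul_eq_mul, Measure.real]
    rw [hc, ← integral_const_mul, ← integral_const_mul, ← integral_add (i2.const_mul 2) (i3.const_mul 2)]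
    refine setIntegral_mono_on i1 ((i2.const_mul 2).add (i3.const_mul 2)) measurableSet_ball fun y _ => ?_
    nlinarith [sq_nonneg (P y - m (n + 1) - (m (n + 1) - mInf))]
  rw [hvol ρ hρ0] at hsplit
  -- the size of `(m (n+1) - mInf)²`
  have hd := hdist (n + 1)
  rw [Real.dist_eq, show (1 : ℝ) - 1 / 2 = 1 / 2 by norm_num] at hd
  have hd' : |m (n + 1) - mInf| ≤ 2 * C₀ * (1 / 2 : ℝ) ^ (n + 1) := by
    have := hd; rw [div_eq_mul_inv, show ((1 : ℝ) / 2)⁻¹ = 2 by norm_num] at this; linarith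
  have hsq : (m (n + 1) - mInf) ^ 2 ≤ (2 * C₀ * (1 / 2 : ℝ) ^ (n + 1)) ^ 2 := by
    have h0 : 0 ≤ 2 * C₀ * (1 / 2 : ℝ) ^ (n + 1) := by positivity
    calc (m (n + 1) - mInf) ^ 2 = |m (n + 1) - mInf| ^ 2 := (sq_abs _).symm
      _ ≤ (2 * C₀ * (1 / 2 : ℝ) ^ (n + 1)) ^ 2 := pow_le_pow_left₀ (abs_nonneg _) hd' 2
  have hC₀sq : C₀ ^ 2 = 6 * K₁ / W := by rw [hC₀, Real.sq_sqrt (by positivity)]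
  -- `ρ³ (1/2)^{2(n+1)} ≤ ρ` since `ρ < 2^{n+1}`
  have hρ3 : ρ ^ 3 * ((1 / 2 : ℝ) ^ (n + 1)) ^ 2 ≤ ρ := by
    have h2 : (0 : ℝ) < 2 ^ (n + 1) := by positivity
    have e : ((1 / 2 : ℝ) ^ (n + 1)) ^ 2 = ((2 : ℝ) ^ (n + 1))⁻¹ ^ 2 := by rw [one_div, inv_pow]
    rw [e, inv_pow, ← div_eq_mul_inv, div_le_iff₀ (by positivity)]
    have : ρ ^ 2 ≤ ((2 : ℝ) ^ (n + 1)) ^ 2 := pow_le_pow_left₀ hρ0.le hn1.le 2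
    nlinarith
  have hm1 := hm (n + 1)
  have h2n : (2 : ℝ) ^ (n + 1) ≤ 2 * ρ := by rw [pow_succ]; linarith
  have hA : 2 * (∫ y in ball (0 : EuclideanSpace ℝ (Fin 3)) ρ, (P y - m (n + 1)) ^ 2) ≤ 4 * K₁ * ρ := by
    nlinarith [hmono, hm1, h2n]
  have hB : 2 * (W * ρ ^ 3 * (m (n + 1) - mInf) ^ 2) ≤ 48 * K₁ * ρ := by
    have h1 : W * ρ ^ 3 * (m (n + 1) - mInf) ^ 2 ≤ W * ρ ^ 3 * (2 * C₀ * (1 / 2 : ℝ) ^ (n + 1)) ^ 2 :=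
      mul_le_mul_of_nonneg_left hsq (by positivity)
    have e : W * ρ ^ 3 * (2 * C₀ * (1 / 2 : ℝ) ^ (n + 1)) ^ 2 = 4 * (W * C₀ ^ 2) * (ρ ^ 3 * ((1 / 2 : ℝ) ^ (n + 1)) ^ 2) := by
      ring
    have e2 : W * C₀ ^ 2 = 6 * K₁ := by rw [hC₀sq]; field_simp
    rw [e, e2] at h1
    nlinarith [h1, hρ3, hK0]
  linarith [hsplit, hA, hB]

/-! ## §2 The `L^{3/2}` slice of the physical pressure -/

section Slices

variable {a : ℝ} {B : EuclideanSpace ℝ (Fin 3) →L[ℝ] EuclideanSpace ℝ (Fin 3)}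
  {P : EuclideanSpace ℝ (Fin 3) → ℝ} {p : ℝ → EuclideanSpace ℝ (Fin 3) → ℝ}

/-- **The `L^{3/2}` slice of the physical pressure** `p(t,x) = λ²P(λe^{−θB}x)`:
`∫_{B(x₀,r)} |p(t)|^{3/2} = ∫_{B(z_t, rλ)} |P|^{3/2}`, `z_t = λe^{−θB}x₀` (scale invariant). [cite: CaffarelliKohnNirenberg1982, §2 (2.3)] -/
theorem setIntegral_ball_abs_rpow_physicalPressure (ha : 0 < a) (hB : ∀ x, inner ℝ (B x) x = 0)
    {t : ℝ} (ht : t < 0)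
    (hp : ∀ x : EuclideanSpace ℝ (Fin 3), p t x = (Real.sqrt (2 * a * (0 - t)))⁻¹ ^ 2 *
      P ((Real.sqrt (2 * a * (0 - t)))⁻¹ •
        (NormedSpace.exp ((-(a⁻¹ * Real.log (Real.sqrt (2 * a * (0 - t)))⁻¹)) • B)) x))
    (x₀ : EuclideanSpace ℝ (Fin 3)) (r : ℝ) :
    ∫ x in ball x₀ r, |p t x| ^ (3 / 2 : ℝ) =
      ∫ y in ball ((Real.sqrt (2 * a * (0 - t)))⁻¹ •
          NormedSpace.exp ((-(a⁻¹ * Real.log (Real.sqrt (2 * a * (0 - t)))⁻¹)) • B) x₀)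
          (r * (Real.sqrt (2 * a * (0 - t)))⁻¹), |P y| ^ (3 / 2 : ℝ) := by
  set lam : ℝ := (Real.sqrt (2 * a * (0 - t)))⁻¹ with hlam
  set θ : ℝ := a⁻¹ * Real.log lam with hθ
  have hlam0 : 0 < lam := scale_pos ha ht
  obtain ⟨L, hL, -⟩ := rss_exists_rot hB θ
  have e : ∀ x, |p t x| ^ (3 / 2 : ℝ) =
      (fun y => lam ^ 3 * |P y| ^ (3 / 2 : ℝ)) (lam • NormedSpace.exp ((-θ) • B) x) := fun x => by
    simp only []
    rw [hp x, abs_mul, abs_of_pos (by positivity : (0 : ℝ) < lam ^ 2),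
      Real.mul_rpow (by positivity) (abs_nonneg _), Lemma142.sq_rpow_three_halves hlam0.le]
  simp_rw [e]
  rw [setIntegral_ball_comp_scale_rot (fun y => lam ^ 3 * |P y| ^ (3 / 2 : ℝ)) hlam0 L hL,
    integral_const_mul, ← mul_assoc, inv_mul_cancel₀ (by positivity), one_mul, hL x₀]

end Slices

/-! ## §3 Hölder on a ball: from `L²` oscillation to `L^{3/2}` -/

/-- For a continuous nonnegative integrand the Lebesgue integral on a ball is `ofReal` of the Bochner integral. [folklore] -/
theorem lintegral_ball_ofReal_eq {f : EuclideanSpace ℝ (Fin 3) → ℝ} (hf : Continuous f) (hf0 : ∀ y, 0 ≤ f y)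
    (z : EuclideanSpace ℝ (Fin 3)) (ρ : ℝ) :
    ∫⁻ y in ball z ρ, ENNReal.ofReal (f y) = ENNReal.ofReal (∫ y in ball z ρ, f y) := by
  rw [ofReal_integral_eq_lintegral_ofReal]
  · exact (hf.continuousOn.integrableOn_compact (isCompact_closedBall z ρ)).mono_set ball_subset_closedBall
  · exact ae_of_all _ hf0

/-- **Hölder on a ball**: if `P'` is continuous with `∫_{B(0,ρ)} P'² ≤ K'ρ` (`ρ > 0`), then
`∫⁻_{B(0,ρ)} ‖P'‖ₑ^{3/2} ≤ ofReal(K'^{3/4} |B₁|^{1/4} ρ^{3/2})`. [cite: CaffarelliKohnNirenberg1982, §2 (2.3)] -/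
theorem lintegral_ball_rpow_threeHalves_le {P' : EuclideanSpace ℝ (Fin 3) → ℝ} (hPc : Continuous P') {K' ρ : ℝ}
    (hρ : 0 < ρ) (hK : ∫ y in ball (0 : EuclideanSpace ℝ (Fin 3)) ρ, (P' y) ^ 2 ≤ K' * ρ) :
    ∫⁻ y in ball (0 : EuclideanSpace ℝ (Fin 3)) ρ, ‖P' y‖ₑ ^ (3 / 2 : ℝ) ≤
      ENNReal.ofReal (K' ^ (3 / 4 : ℝ) * (volume (ball (0 : EuclideanSpace ℝ (Fin 3)) 1)).toReal ^ (1 / 4 : ℝ) *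
        ρ ^ (3 / 2 : ℝ)) := by
  set W : ℝ := (volume (ball (0 : EuclideanSpace ℝ (Fin 3)) 1)).toReal with hW
  have hK0 : 0 ≤ K' := by
    have h0 : 0 ≤ ∫ y in ball (0 : EuclideanSpace ℝ (Fin 3)) ρ, (P' y) ^ 2 := integral_nonneg fun y => sq_nonneg _
    nlinarith
  have hH := setLIntegral_rpow_threeHalves_le_of_sq volume (ball (0 : EuclideanSpace ℝ (Fin 3)) ρ)
    (g := P') hPc.measurable.aemeasurable
  -- the `L²` factor
  have h2 : ∫⁻ y in ball (0 : EuclideanSpace ℝ (Fin 3)) ρ, ‖P' y‖ₑ ^ 2 ≤ ENNReal.ofReal (K' * ρ) := by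
    have e : ∀ y, ‖P' y‖ₑ ^ 2 = ENNReal.ofReal ((P' y) ^ 2) := fun y => by
      rw [← ofReal_norm, ← ENNReal.ofReal_pow (norm_nonneg _), Real.norm_eq_abs, sq_abs]
    simp_rw [e]
    rw [lintegral_ball_ofReal_eq (f := fun y => (P' y) ^ 2) (hPc.pow 2) (fun y => sq_nonneg _)]
    exact ENNReal.ofReal_le_ofReal hK
  -- the volume factor
  have hvol : volume (ball (0 : EuclideanSpace ℝ (Fin 3)) ρ) = ENNReal.ofReal (W * ρ ^ 3) := by
    rw [Measure.addHaar_ball_of_pos volume 0 hρ, finrank_euclideanSpace_fin, hW, ENNReal.ofReal_mul (by positivity),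
      ENNReal.ofReal_toReal measure_ball_lt_top.ne, mul_comm]
  refine hH.trans ?_
  rw [hvol]
  calc (∫⁻ y in ball (0 : EuclideanSpace ℝ (Fin 3)) ρ, ‖P' y‖ₑ ^ 2) ^ (3 / 4 : ℝ) * ENNReal.ofReal (W * ρ ^ 3) ^ (1 / 4 : ℝ)
      ≤ ENNReal.ofReal (K' * ρ) ^ (3 / 4 : ℝ) * ENNReal.ofReal (W * ρ ^ 3) ^ (1 / 4 : ℝ) := by
        gcongr
    _ = ENNReal.ofReal ((K' * ρ) ^ (3 / 4 : ℝ) * (W * ρ ^ 3) ^ (1 / 4 : ℝ)) := by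
        rw [ENNReal.ofReal_rpow_of_nonneg (by positivity) (by norm_num),
          ENNReal.ofReal_rpow_of_nonneg (by positivity) (by norm_num), ← ENNReal.ofReal_mul (by positivity)]
    _ = ENNReal.ofReal (K' ^ (3 / 4 : ℝ) * W ^ (1 / 4 : ℝ) * ρ ^ (3 / 2 : ℝ)) := by
        congr 1
        rw [Real.mul_rpow hK0 hρ.le, Real.mul_rpow (by positivity) (by positivity),
          show ρ ^ 3 = ρ ^ (3 : ℝ) by norm_cast, ← Real.rpow_mul hρ.le,
          show (3 : ℝ) * (1 / 4) = 3 / 4 by norm_num]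
        have e : ρ ^ (3 / 2 : ℝ) = ρ ^ (3 / 4 : ℝ) * ρ ^ (3 / 4 : ℝ) := by
          rw [← Real.rpow_add hρ]; norm_num
        rw [e]; ring

end LocalEnergyRescue

end Summit.NavierStokesRegularity.NavierStokesRegularity.Theorems.CoriolisHead

end
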